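import Summits.BirchSwinnertonDyer.BirchSwinnertonDyer.Theorems.ClassRecordThreeCornerAtThreeShimuraSplitAuxNormE0Prime
import HarnessLib

/-!
# r17 of `Cruxes/CornerAtThreeW/Lines/inert.lean` — the corner's SAVED display D from THREE PRINT ∕ LOCAL ∕ CHEBOTAREV-GRADE STUB TEXTS:
# the split-norm primitives, the carrier-local E₀ inputs (tam3-p1 g18's `stub_carrierLocalE0AtThree` text VERBATIM, shared with 19109 r17),
# and the auxiliary SPLIT level on the corner frames — NO identity-component ∕ E′ label anywhere
# (cell `bsd-stepL`, seat `bsd-stepL-corner3-p2` g14 = lane B, LINE OWNER of crux 21420 `CornerAtThreeW`; `--supports stmt-BirchSwinnertonDyer-21420 --as helper`)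

WHY. Lane B g14's `…ShimuraSplitAuxNormE0Prime` (p643495) derives `CornerAtThreeShimuraInertSavedDisplayD` — the `hIs` binder of lane B g12's anchor consumer
`cornerAtThreeUpperConsumed_of_displays_of_residualAnchor_of_twinLowerD` — from {`casselsTate_levelInputs`, `ShimuraWalk.PrimitivesWithSplitNormTDAtThree`,
(T), (C), `AuxiliarySplitLevel` on corner frames}. THIS FILE restates that composition on the EXACT stub texts of the r17 candidate of 21420's line:
* conjunct (b) = tam3-p1 g18's `stub_carrierLocalE0AtThree` of 19109 r17 VERBATIM — (T) ∧ (C) at every prime `q` with `3 ∣ c_q(E/ℚ_q)` split in `K`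
  (keyed on `3 ∣ c_q`, NOT on split multiplicative reduction: at split `I_n`, `IV`, `IV*` all geometric components are `𝔽_q`-rational; Silverman ATAEC IV 9.2 (d),
  C.15) — ONE text for both lines;
* conjunct (c) = `AuxiliarySplitLevel W K ι 3 q N` on the CORNER frames (`ClassX11b W 3 ∧ ¬ Surj W 3`, `K` imaginary quadratic with `d_K < −4` and `3` inert,
  `q` split in `K` with `3 ∣ c_q`, `N ≠ 0`) — the split twin of 19109 r17's `stub_auxiliaryInertLevelAtThree` (which is asked on `Surj` frames, where the inert
  level works; on the corner's 3Ns images it is void, lane B g13 p638602); THEOREM-GRADE by memo CORNER3-G14 §2 (Chebotarev–Kummer with `Frob = −I`: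
  `−I ∈ [G,G]` for every corner image, `K ∩ ℚ(E[3]) = ℚ` for `3` inert in `K`, Kummer fibre ramified at `𝔮`);
* conjunct (a) = `ShimuraWalk.PrimitivesWithSplitNormTDAtThree` (lane B g14 p642549; print-level by statement: Darmon 2004 Def. 3.12 ∕ Prop. 3.10 ∕ Thm. 4.18).
Theorems: `cornerE0PrimeSupplier_of_carrierLocalE0_of_splitAuxLevelAtThree` ((b) ∧ (c) ⟹ the corner E′-supplier, §1 of p643495 per carrier) and
`cornerAtThreeShimuraInertSavedDisplayD_of_residualStubsR17_of_casselsTate` ((a) ∧ (b) ∧ (c) + `hCT` ⟹ the display, §3 of p643495).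
HONEST FRAMING: THEOREMS ONLY (no definition, no named fact, no `sorry`); (a), (b), (c), `hCT` are HYPOTHESES; nothing closes; 21420 OPEN; no census label
moves (T7); BSD is proved for no curve. References (locators only): [cite: Darmon2004, Prop. 3.10, Def. 3.12, Thm. 4.18] [cite: GrossLMS1991, §6 p. 245]
[cite: SilvermanATAEC1994, IV Cor. 9.2 (d), C.15] [cite: Cox2013, §7.D Thm. 7.24, Thm. 8.12]. presearch: n∕a (re-keying of p643495 on stub texts).
Axioms: `propext`, `Classical.choice`, `Quot.sound`.
-/

set_option autoImplicit false
set_option linter.dupNamespace false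

noncomputable section

open scoped Classical NumberField Pointwise

namespace Summit.BirchSwinnertonDyer.BirchSwinnertonDyer.Theorems.ShimuraWalk

open WeierstrassCurve IsDedekindDomain NumberField Field Function Literature.NumberTheory.EllipticCurves
  Literature.NumberTheory.EllipticCurves.ModularForms Literature.NumberTheory.EllipticCurves.Rank1Residual
  Literature.NumberTheory.GaloisRepresentations Literature.NumberTheory.Automorphic
  Literature.NumberTheory.NumberFields Literature.NumberTheory.NumberFields.RingClassField
  Summit.BirchSwinnertonDyer.Rank1Residual Summit.BirchSwinnertonDyer.Rank1Residual.X11b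
  Summit.BirchSwinnertonDyer.Rank1Residual.X11b.Three
  Literature.NumberTheory.EllipticCurves.ShimuraCMFamily

/-- **The corner E′-SUPPLIER from the r17 stub texts (b) ∧ (c)** — (b) = tam3-p1 g18's `stub_carrierLocalE0AtThree` VERBATIM ((T) ∧ (C) at every `q` with
`3 ∣ c_q` split in `K`), (c) = `AuxiliarySplitLevel W K ι 3 q N` on the corner frames; output = the binder `hE0sup` of
`cornerAtThreeShimuraInertSavedDisplayD_of_primitivesWithSplitNormTD_of_E0PrimeSupplier_of_casselsTate` (p643495 §3), through its §1
`labelE0Prime_at_carrier_of_galTrivial_of_kills_of_splitAuxLevel`. CONDITIONAL; nothing booked. [cite: Darmon2004, Prop. 3.10]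
[cite: GrossLMS1991, §6 p. 245] [cite: SilvermanATAEC1994, IV Cor. 9.2 (d), C.15] -/
theorem cornerE0PrimeSupplier_of_carrierLocalE0_of_splitAuxLevelAtThree
    (hTC : ∀ (W : WeierstrassCurve ℚ) [W.IsElliptic] [W.IsGloballyMinimal] (K : Type) [Field K] [NumberField K] (ι : K →+* ℂ)
      [∀ j : ℕ, NumberField (ringClassField K ι j)],
      IsImaginaryQuadratic K → ∀ (q : ℕ) [Fact q.Prime], 3 ∣ (W.baseChange ℚ_[q]).localTamagawaNumber ℤ_[q] →
      ((Ideal.span {(q : ℤ)}).primesOver (𝓞 K)).ncard = 2 →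
      (∀ n : ℕ, n ≠ 0 → ¬ q ∣ n → ∀ (w : HeightOneSpectrum (𝓞 (ringClassField K ι n))),
        ((q : ℕ) : 𝓞 (ringClassField K ι n)) ∈ w.asIdeal →
        ∀ τ : ringClassField K ι n ≃ₐ[ℚ] ringClassField K ι n, τ • w.asIdeal = w.asIdeal →
        ∀ P : (W.baseChange (ringClassField K ι n)).toAffine.Point,
          (placeIntModel W (ringClassField K ι n) w).HasNonsingularReduction (K := ringClassField K ι n)
            (pointGalHom W (ringClassField K ι n) τ P - P)) ∧
      (∀ n : ℕ, n ≠ 0 → ¬ q ∣ n → ∀ (w : HeightOneSpectrum (𝓞 (ringClassField K ι n))),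
        ((q : ℕ) : 𝓞 (ringClassField K ι n)) ∈ w.asIdeal →
        ∀ P : (W.baseChange (ringClassField K ι n)).toAffine.Point,
          (placeIntModel W (ringClassField K ι n) w).HasNonsingularReduction (K := ringClassField K ι n)
            ((W.baseChange ℚ_[q]).localTamagawaNumber ℤ_[q] • P)))
    (hAuxS : ∀ (W : WeierstrassCurve ℚ) [W.IsElliptic] [W.IsGloballyMinimal] (K : Type) [Field K] [NumberField K] (ι : K →+* ℂ)
      [∀ j : ℕ, NumberField (ringClassField K ι j)],
      IsImaginaryQuadratic K → NumberField.discr K < -4 →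
      ((Ideal.span {(3 : ℤ)}).primesOver (𝓞 K)).ncard = 1 → ¬ (3 : ℤ) ∣ NumberField.discr K →
      ClassX11b W 3 → ¬ Surj W 3 →
      ∀ (q N : ℕ) [Fact q.Prime], ((Ideal.span {(q : ℤ)}).primesOver (𝓞 K)).ncard = 2 → N ≠ 0 →
      3 ∣ (W.baseChange ℚ_[q]).localTamagawaNumber ℤ_[q] → AuxiliarySplitLevel W K ι 3 q N) :
    ∀ (W : WeierstrassCurve ℚ) [W.IsElliptic] [W.IsGloballyMinimal] (N : ℕ) [NeZero N] (K : Type) [Field K] [NumberField K]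
      (S : Finset ℕ), ClassX11b W 3 → ¬ Surj W 3 → W.conductorNorm ℤ = N →
      ∀ (hK : IsImaginaryQuadratic K), NumberField.discr K < -4 →
      (∀ ℓ ∈ S, ℓ.Prime ∧ ℓ ∣ N ∧ ¬ ℓ ^ 2 ∣ N ∧
        ((Ideal.span {(ℓ : ℤ)}).primesOver (𝓞 K)).ncard = 1 ∧ ¬ (ℓ : ℤ) ∣ NumberField.discr K) →
      (∀ ℓ : ℕ, ℓ.Prime → ℓ ∣ N → ℓ ∉ S → ((Ideal.span {(ℓ : ℤ)}).primesOver (𝓞 K)).ncard = 2) →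
      3 ∈ S →
      ∀ (ι : K →+* ℂ) (y : (W.baseChange K).toAffine.Point)
        (ys : (m : ℕ) → (W.baseChange (ringClassField K ι m)).toAffine.Point) (ε : ℤ),
        LabelsAt W N K ι y ys ε → SplitNormAt W N K ι ys →
        ∀ (q : ℕ) [Fact q.Prime], q ∣ N → q ∉ S → 3 ∣ (W.baseChange ℚ_[q]).localTamagawaNumber ℤ_[q] →
          ∃ n' : ℕ, ¬ 3 ∣ n' ∧ ∀ m : ℕ, Squarefree m →
            (∀ r ∈ m.primeFactors, ¬ r ∣ N ∧ (Ideal.span {(r : 𝓞 K)}).IsPrime) →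
            ∀ [NumberField (ringClassField K ι m)] (w : HeightOneSpectrum (𝓞 (ringClassField K ι m))),
              ((q : ℕ) : 𝓞 (ringClassField K ι m)) ∈ w.asIdeal →
              (placeIntModel W (ringClassField K ι m) w).HasNonsingularReduction (K := ringClassField K ι m) (n' • ys m) := by
  intro W _ _ N _ K _ _ S hX hns _hN hK hD hin hsp h3S ι y ys ε _hL hSN q _ hqN hqS h3q
  haveI : ∀ j : ℕ, NumberField (ringClassField K ι j) := Summit.BirchSwinnertonDyer.Rank1Residual.JET.numberField_ringClassField K hK ι
  haveI : (W.baseChange ℚ_[q]).IsElliptic := inferInstanceAs (W.map (algebraMap ℚ ℚ_[q])).IsElliptic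
  have hq2 := hsp q (Fact.out : q.Prime) hqN hqS
  have hc0 : (W.baseChange ℚ_[q]).localTamagawaNumber ℤ_[q] ≠ 0 :=
    localTamagawaNumber_padic_ne_zero_holds q (W.baseChange ℚ_[q])
  obtain ⟨hT, hC⟩ := hTC W K ι hK q h3q hq2
  exact labelE0Prime_at_carrier_of_galTrivial_of_kills_of_splitAuxLevel W ι hK hqN hc0 hT hC
    (hAuxS W K ι hK hD (hin 3 h3S).2.2.2.1 (hin 3 h3S).2.2.2.2 hX hns q N hq2 (NeZero.ne N) h3q) ys hSN

/-- **`CornerAtThreeShimuraInertSavedDisplayD` from the Cassels–Tate level inputs and the r17 stub text `(a) ∧ (b) ∧ (c)`** — (a) the split-norm primitives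
`ShimuraWalk.PrimitivesWithSplitNormTDAtThree` (print-level by statement), (b) tam3-p1 g18's `stub_carrierLocalE0AtThree` text (shared with 19109 r17),
(c) `AuxiliarySplitLevel` on the corner frames: §3 of p643495 on the supplier above. This IS the `hIs` binder of lane B g12's anchor consumer
`cornerAtThreeUpperConsumed_of_displays_of_residualAnchor_of_twinLowerD` — so r17's `cornerUpperConsumed3_of_inertStubs` is that consumer on this theorem.
NO identity-component ∕ E′ label among the hypotheses. CONDITIONAL; nothing closes; BSD is proved for no curve.
[cite: Darmon2004, Prop. 3.10, Thm. 4.18] [cite: Jetchev2008, Thm. 1.1, Thm. 1.4] [cite: SilvermanATAEC1994, IV Cor. 9.2 (d)] [cite: MilneADT2006, Ch. I Thm. 4.10, §6] -/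
theorem cornerAtThreeShimuraInertSavedDisplayD_of_residualStubsR17_of_casselsTate
    (hCT : ∀ (K : Type) [Field K] [NumberField K], Literature.NumberTheory.EllipticCurves.casselsTate_levelInputs K)
    (hres :
      PrimitivesWithSplitNormTDAtThree ∧
      (∀ (W : WeierstrassCurve ℚ) [W.IsElliptic] [W.IsGloballyMinimal] (K : Type) [Field K] [NumberField K] (ι : K →+* ℂ)
        [∀ j : ℕ, NumberField (ringClassField K ι j)],
        IsImaginaryQuadratic K → ∀ (q : ℕ) [Fact q.Prime], 3 ∣ (W.baseChange ℚ_[q]).localTamagawaNumber ℤ_[q] →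
        ((Ideal.span {(q : ℤ)}).primesOver (𝓞 K)).ncard = 2 →
        (∀ n : ℕ, n ≠ 0 → ¬ q ∣ n → ∀ (w : HeightOneSpectrum (𝓞 (ringClassField K ι n))),
          ((q : ℕ) : 𝓞 (ringClassField K ι n)) ∈ w.asIdeal →
          ∀ τ : ringClassField K ι n ≃ₐ[ℚ] ringClassField K ι n, τ • w.asIdeal = w.asIdeal →
          ∀ P : (W.baseChange (ringClassField K ι n)).toAffine.Point,
            (placeIntModel W (ringClassField K ι n) w).HasNonsingularReduction (K := ringClassField K ι n)
              (pointGalHom W (ringClassField K ι n) τ P - P)) ∧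
        (∀ n : ℕ, n ≠ 0 → ¬ q ∣ n → ∀ (w : HeightOneSpectrum (𝓞 (ringClassField K ι n))),
          ((q : ℕ) : 𝓞 (ringClassField K ι n)) ∈ w.asIdeal →
          ∀ P : (W.baseChange (ringClassField K ι n)).toAffine.Point,
            (placeIntModel W (ringClassField K ι n) w).HasNonsingularReduction (K := ringClassField K ι n)
              ((W.baseChange ℚ_[q]).localTamagawaNumber ℤ_[q] • P))) ∧
      (∀ (W : WeierstrassCurve ℚ) [W.IsElliptic] [W.IsGloballyMinimal] (K : Type) [Field K] [NumberField K] (ι : K →+* ℂ)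
        [∀ j : ℕ, NumberField (ringClassField K ι j)],
        IsImaginaryQuadratic K → NumberField.discr K < -4 →
        ((Ideal.span {(3 : ℤ)}).primesOver (𝓞 K)).ncard = 1 → ¬ (3 : ℤ) ∣ NumberField.discr K →
        ClassX11b W 3 → ¬ Surj W 3 →
        ∀ (q N : ℕ) [Fact q.Prime], ((Ideal.span {(q : ℤ)}).primesOver (𝓞 K)).ncard = 2 → N ≠ 0 →
        3 ∣ (W.baseChange ℚ_[q]).localTamagawaNumber ℤ_[q] → AuxiliarySplitLevel W K ι 3 q N)) :
    CornerAtThreeShimuraInertSavedDisplayD :=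
  cornerAtThreeShimuraInertSavedDisplayD_of_primitivesWithSplitNormTD_of_E0PrimeSupplier_of_casselsTate hCT hres.1
    (cornerE0PrimeSupplier_of_carrierLocalE0_of_splitAuxLevelAtThree hres.2.1 hres.2.2)

end Summit.BirchSwinnertonDyer.BirchSwinnertonDyer.Theorems.ShimuraWalk

end
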